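import Summits.ABC.StewartYu.PadicW80ParLD
import HarnessLib

/-!
# The `(log p)`-normalised parameter record `PadicW80ParL` — part E: the endgame numbers

Support file (theorems only; no named facts), cell `abc-stewartyu` (p1, stub S5 of memo-03 §4): twin of
`PadicW80ParE.lean` on the `ℓ`-normalised record. `∑ⱼ⌊Lⱼ/2^{J₀}⌋ ≤ 4m nV_θ` (floor `Vⱼ ≥ ℓ`: `Lⱼ/L_θ ≲ V_θ/Vⱼ ≤ nV_θ`),
`T/2^{J₀} ≥ 2¹⁰ m² nV_θ − 1`, and the endgame numbers `∑⌊Lⱼ/2^{J₀}⌋ + 1 ≤ ⌊T/2^{J₀}⌋`,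
`h L_b < (⌊T/2^{J₀}⌋ − ∑⌊Lⱼ/2^{J₀}⌋) · #{odd s < 2^{J₀}S₀}` (now `≈ m𝔘/(128ℓ)` against `h L_b ≤ (𝔘/c_L + 4W⋆)/ℓ`,
via `h L_b ℓ ≤ h L_b G`). Design note HOME/p1/S5-logp-ledger.md. [cite: Waldschmidt1980, §3.5 (p. 274)]
-/

noncomputable section

open Finset Real
open Literature.NumberTheory.Transcendental Literature.NumberTheory.Transcendental.Waldschmidt1980

namespace Summit.ABC.StewartYu

open PadicW80Par (cTp cSp cLp cLp' Ap mRp)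

namespace PadicW80ParL

variable {d : ℕ} (P : PadicW80ParL d)

/-- `∑ⱼ ⌊Lⱼ/2^{J₀}⌋ ≤ 4 m nV_θ` (real): `Lⱼ ≤ (2L_θ+2)V_θ/ℓ` by the floor `Vⱼ ≥ ℓ`, `2^{J₀} > L_θ`. [folklore] -/
theorem sum_L_div_le : ((∑ j, P.Lℓ j / 2 ^ P.J₀ℓ : ℕ) : ℝ) ≤ 4 * mRp d * P.nVθ := by
  have hLθ := P.Lθ_ge
  have hden := P.den_Lθ_pos
  have hL1 : (1 : ℝ) ≤ P.Lθℓ := by exact_mod_cast P.one_le_Lθ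
  have hJ : (P.Lθℓ : ℝ) < (2 : ℝ) ^ P.J₀ℓ := by exact_mod_cast P.Lθ_lt_two_pow
  have hVθ := P.one_le_nVθ
  have hℓ := P.ℓ_pos
  have hj : ∀ j, ((P.Lℓ j / 2 ^ P.J₀ℓ : ℕ) : ℝ) ≤ 4 * P.nVθ := by
    intro j
    have h1 : ((P.Lℓ j / 2 ^ P.J₀ℓ : ℕ) : ℝ) ≤ (P.Lℓ j : ℝ) / 2 ^ P.J₀ℓ := by
      have := Nat.cast_div_le (α := ℝ) (m := P.Lℓ j) (n := 2 ^ P.J₀ℓ); push_cast at this; exact this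
    have h0 : 0 < cLp' * mRp d * 2 ^ (d + 2) * (P.S₀ℓ : ℝ) := by unfold cLp'; have := mR_pos P; have := P.S₀_pos; positivity
    have hVj := P.hVℓ j
    have hU := P.U_pos
    have hLj : (P.Lℓ j : ℝ) ≤ P.Uℓ / (cLp' * mRp d * 2 ^ (d + 2) * P.S₀ℓ * P.V j) := by
      unfold Lℓ; exact Nat.floor_le (div_nonneg hU.le (by have := P.hV j; positivity))
    have h3 : P.Uℓ / (cLp' * mRp d * 2 ^ (d + 2) * P.S₀ℓ * P.V j) ≤
        P.Uℓ / (cLp' * mRp d * 2 ^ (d + 2) * P.S₀ℓ * P.Vθ) * P.nVθ := by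
      have h3a : P.Uℓ / (cLp' * mRp d * 2 ^ (d + 2) * P.S₀ℓ * P.V j) ≤ P.Uℓ / (cLp' * mRp d * 2 ^ (d + 2) * P.S₀ℓ * P.ℓ) :=
        div_le_div_of_nonneg_left hU.le (by positivity) (mul_le_mul_of_nonneg_left hVj h0.le)
      have h3b : P.Uℓ / (cLp' * mRp d * 2 ^ (d + 2) * P.S₀ℓ * P.ℓ) =
          P.Uℓ / (cLp' * mRp d * 2 ^ (d + 2) * P.S₀ℓ * P.Vθ) * P.nVθ := by
        have hVθ0 : P.Vθ ≠ 0 := by linarith [P.hVθ1]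
        unfold nVθ; field_simp
      rw [← h3b]; exact h3a
    have h5 : (P.Lℓ j : ℝ) ≤ (2 * P.Lθℓ + 2) * P.nVθ := hLj.trans (h3.trans (by nlinarith))
    have h6 : (P.Lℓ j : ℝ) / 2 ^ P.J₀ℓ ≤ (2 * P.Lθℓ + 2) * P.nVθ / P.Lθℓ := by
      calc (P.Lℓ j : ℝ) / 2 ^ P.J₀ℓ ≤ (P.Lℓ j : ℝ) / P.Lθℓ := div_le_div_of_nonneg_left (Nat.cast_nonneg _) (by linarith) hJ.le
        _ ≤ (2 * P.Lθℓ + 2) * P.nVθ / P.Lθℓ := div_le_div_of_nonneg_right h5 (by linarith)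
    have h7 : (2 * P.Lθℓ + 2) * P.nVθ / P.Lθℓ ≤ 4 * P.nVθ := by
      rw [div_le_iff₀ (by linarith)]; nlinarith
    linarith
  push_cast
  calc ∑ j, ((P.Lℓ j / 2 ^ P.J₀ℓ : ℕ) : ℝ) ≤ ∑ _j : Fin d, 4 * P.nVθ := sum_le_sum fun j _ => hj j
    _ = d * (4 * P.nVθ) := by simp
    _ ≤ 4 * mRp d * P.nVθ := by unfold mRp; nlinarith

/-- `T/2^{J₀} ≥ 2¹⁰ m² nV_θ − 1` (real). [folklore] -/
theorem T_div_ge : (2 : ℝ) ^ 10 * mRp d ^ 2 * P.nVθ - 1 ≤ ((P.Tℓ / 2 ^ P.J₀ℓ : ℕ) : ℝ) := by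
  have h1 : (P.Tℓ : ℝ) / ((2 ^ P.J₀ℓ : ℕ) : ℝ) - 1 ≤ ((P.Tℓ / 2 ^ P.J₀ℓ : ℕ) : ℝ) := by
    have hb : 0 < 2 ^ P.J₀ℓ := Nat.pow_pos two_pos
    have h := Nat.lt_div_mul_add hb (a := P.Tℓ)
    have hb' : (0 : ℝ) < ((2 ^ P.J₀ℓ : ℕ) : ℝ) := by exact_mod_cast hb
    rw [div_sub_one hb'.ne', div_le_iff₀ hb']
    have : (P.Tℓ : ℝ) < (P.Tℓ / 2 ^ P.J₀ℓ : ℕ) * ((2 ^ P.J₀ℓ : ℕ) : ℝ) + ((2 ^ P.J₀ℓ : ℕ) : ℝ) := by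
      exact_mod_cast h
    linarith
  push_cast at h1
  have h2 := P.T_ge_Lθ
  have h3 : ((2 : ℝ) ^ P.J₀ℓ) ≤ 2 * P.Lθℓ := by exact_mod_cast P.two_pow_le
  have hL1 : (1 : ℝ) ≤ P.Lθℓ := by exact_mod_cast P.one_le_Lθ
  have h4 : (2 : ℝ) ^ 10 * mRp d ^ 2 * P.nVθ ≤ (P.Tℓ : ℝ) / 2 ^ P.J₀ℓ := by
    rw [le_div_iff₀ (by positivity)]
    calc (2 : ℝ) ^ 10 * mRp d ^ 2 * P.nVθ * 2 ^ P.J₀ℓ ≤ 2 ^ 10 * mRp d ^ 2 * P.nVθ * (2 * P.Lθℓ) := by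
          have := P.one_le_nVθ; gcongr
      _ = 2 ^ 11 * mRp d ^ 2 * P.nVθ * P.Lθℓ := by ring
      _ ≤ P.Tℓ := h2
  linarith

/-- **The numbers of the endgame**: `∑ⱼ ⌊Lⱼ/2^{J₀}⌋ + 1 ≤ ⌊T/2^{J₀}⌋` and
`h L_b < (⌊T/2^{J₀}⌋ − ∑ⱼ ⌊Lⱼ/2^{J₀}⌋) · #{odd s < 2^{J₀} S₀}` (the latter is `≥ m 𝔘/(128ℓ)`, the
former `≤ (𝔘/c_L + 4W⋆)/ℓ` by `h L_b ℓ ≤ h L_b G`). [cite: Waldschmidt1980, §3.5 (p. 274)] -/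
theorem endgame_numbers :
    (∑ j, P.Lℓ j / 2 ^ P.J₀ℓ) + 1 ≤ P.Tℓ / 2 ^ P.J₀ℓ ∧
      P.hparℓ * P.Lbℓ < (P.Tℓ / 2 ^ P.J₀ℓ - ∑ j, P.Lℓ j / 2 ^ P.J₀ℓ) * ((range (2 ^ P.J₀ℓ * P.S₀ℓ)).filter Odd).card := by
  have hsum := P.sum_L_div_le
  have hTd := P.T_div_ge
  have hm := two_le_mR P; have hm0 := mR_pos P; have hVθ := P.one_le_nVθ; have hW := P.one_le_Wstar
  have hU := P.𝔘_pos; have hℓ := P.ℓ_pos; have hℓ1 := P.hℓ; have hnW := P.one_le_nWstar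
  -- (1) the first claim, in the reals
  have h1real : ((∑ j, P.Lℓ j / 2 ^ P.J₀ℓ : ℕ) : ℝ) + 1 ≤ ((P.Tℓ / 2 ^ P.J₀ℓ : ℕ) : ℝ) := by
    have : 4 * mRp d * P.nVθ + 1 ≤ (2 : ℝ) ^ 10 * mRp d ^ 2 * P.nVθ - 1 := by nlinarith
    linarith
  have h1 : (∑ j, P.Lℓ j / 2 ^ P.J₀ℓ) + 1 ≤ P.Tℓ / 2 ^ P.J₀ℓ := by exact_mod_cast h1real
  refine ⟨h1, ?_⟩
  -- (2) the second claim
  rw [P.card_odd_eq]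
  have hsub : (((P.Tℓ / 2 ^ P.J₀ℓ - ∑ j, P.Lℓ j / 2 ^ P.J₀ℓ : ℕ)) : ℝ) = ((P.Tℓ / 2 ^ P.J₀ℓ : ℕ) : ℝ) - ((∑ j, P.Lℓ j / 2 ^ P.J₀ℓ : ℕ) : ℝ) := by
    rw [Nat.cast_sub (by omega)]
  have hT' : (2 : ℝ) ^ 9 * mRp d ^ 2 * P.nVθ ≤ ((P.Tℓ / 2 ^ P.J₀ℓ - ∑ j, P.Lℓ j / 2 ^ P.J₀ℓ : ℕ) : ℝ) := by
    rw [hsub]; nlinarith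
  -- `#odd = 2^{J₀} ⌊c_S m nW⋆⌋ ≥ Lθ (c_S m nW⋆ − 1) ≥ Lθ c_S m nW⋆ / 2`
  have hfl : cSp * mRp d * P.nWstarℓ - 1 ≤ (⌊cSp * mRp d * P.nWstarℓ⌋₊ : ℝ) := by
    have := Nat.lt_floor_add_one (cSp * mRp d * P.nWstarℓ); linarith
  have hcS := P.cS_mul_ge
  have hJ : (P.Lθℓ : ℝ) ≤ (2 : ℝ) ^ P.J₀ℓ := by exact_mod_cast P.Lθ_lt_two_pow.le
  have hodd : (P.Lθℓ : ℝ) * (cSp * mRp d * P.nWstarℓ / 2) ≤ ((2 ^ P.J₀ℓ * ⌊cSp * mRp d * P.nWstarℓ⌋₊ : ℕ) : ℝ) := by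
    push_cast
    have h2 : cSp * mRp d * P.nWstarℓ / 2 ≤ (⌊cSp * mRp d * P.nWstarℓ⌋₊ : ℝ) := by linarith
    exact mul_le_mul hJ h2 (by linarith) (by positivity)
  -- `Lθ nVθ ≥ 𝔘/(8 c_L' c_S m² W⋆)` (`S₀ ≤ 2c_S m nW⋆`, `Vθ = ℓ nVθ`, `ℓ nW⋆ = W⋆`)
  have hLθ := P.Lθ_ge
  have hS := P.S₀_le; have hS0 := P.S₀_pos
  have hLV : P.𝔘ℓ / (8 * cLp' * cSp * mRp d ^ 2 * P.Wstarℓ) ≤ (P.Lθℓ : ℝ) * P.nVθ := by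
    have hden := P.den_Lθ_pos
    have e : P.Uℓ / (cLp' * mRp d * 2 ^ (d + 2) * P.S₀ℓ * P.Vθ) / 2 = P.𝔘ℓ / (4 * cLp' * mRp d * P.S₀ℓ * P.Vθ) := by
      rw [P.U_eq, pow_succ]; field_simp; ring
    rw [e] at hLθ
    have hVθ0 : 0 < P.Vθ := by linarith [P.hVθ1]
    have h2 : P.𝔘ℓ / (8 * cLp' * cSp * mRp d ^ 2 * P.Wstarℓ) ≤ P.𝔘ℓ / (4 * cLp' * mRp d * P.S₀ℓ * P.Vθ) * P.nVθ := by
      rw [div_mul_eq_mul_div, div_le_div_iff₀ (by unfold cLp' cSp; positivity) (by unfold cLp'; positivity)]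
      -- `𝔘 (4 c_L' m S₀ Vθ) ≤ 𝔘 nVθ (8 c_L' c_S m² W⋆)` iff `S₀ ℓ ≤ 2 c_S m W⋆` (as `Vθ = ℓ nVθ`, `W⋆ = ℓ nW⋆`)
      have hSW : (P.S₀ℓ : ℝ) * P.Vθ ≤ 2 * cSp * mRp d * P.Wstarℓ * P.nVθ := by
        rw [P.Vθ_eq, P.Wstar_eq]
        have : (P.S₀ℓ : ℝ) * (P.ℓ * P.nVθ) = (P.S₀ℓ * P.ℓ) * P.nVθ := by ring
        rw [this]
        have hSℓ : (P.S₀ℓ : ℝ) * P.ℓ ≤ 2 * cSp * mRp d * (P.ℓ * P.nWstarℓ) := by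
          calc (P.S₀ℓ : ℝ) * P.ℓ ≤ (2 * (cSp * mRp d * P.nWstarℓ)) * P.ℓ := mul_le_mul_of_nonneg_right hS hℓ.le
            _ = 2 * cSp * mRp d * (P.ℓ * P.nWstarℓ) := by ring
        exact mul_le_mul_of_nonneg_right hSℓ (by linarith)
      have h0 : 0 ≤ P.𝔘ℓ := hU.le
      have : 4 * cLp' * mRp d * ((P.S₀ℓ : ℝ) * P.Vθ) ≤ P.nVθ * (8 * cLp' * cSp * mRp d ^ 2 * P.Wstarℓ) := by
        have h4 : (0 : ℝ) ≤ 4 * cLp' * mRp d := by unfold cLp'; positivity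
        calc 4 * cLp' * mRp d * ((P.S₀ℓ : ℝ) * P.Vθ) ≤ 4 * cLp' * mRp d * (2 * cSp * mRp d * P.Wstarℓ * P.nVθ) :=
              mul_le_mul_of_nonneg_left hSW h4
          _ = P.nVθ * (8 * cLp' * cSp * mRp d ^ 2 * P.Wstarℓ) := by ring
      calc P.𝔘ℓ * (4 * cLp' * mRp d * (P.S₀ℓ : ℝ) * P.Vθ) = P.𝔘ℓ * (4 * cLp' * mRp d * ((P.S₀ℓ : ℝ) * P.Vθ)) := by ring
        _ ≤ P.𝔘ℓ * (P.nVθ * (8 * cLp' * cSp * mRp d ^ 2 * P.Wstarℓ)) := mul_le_mul_of_nonneg_left this h0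
        _ = P.𝔘ℓ * P.nVθ * (8 * cLp' * cSp * mRp d ^ 2 * P.Wstarℓ) := by ring
    calc P.𝔘ℓ / (8 * cLp' * cSp * mRp d ^ 2 * P.Wstarℓ) ≤ P.𝔘ℓ / (4 * cLp' * mRp d * P.S₀ℓ * P.Vθ) * P.nVθ := h2
      _ ≤ (P.Lθℓ : ℝ) * P.nVθ := mul_le_mul_of_nonneg_right hLθ (by linarith)
  -- assemble in the reals: `h L_b ℓ ≤ 𝔘/c_L + W⋆ + G ≤ 𝔘/c_L + 4W⋆`
  have hlhs := P.hparLbℓ_le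
  have hGW := P.G_le_three_Wstar
  have hWU := P.Wstar_le_𝔘
  suffices key : (P.hparℓ : ℝ) * P.Lbℓ < ((P.Tℓ / 2 ^ P.J₀ℓ - ∑ j, P.Lℓ j / 2 ^ P.J₀ℓ : ℕ) : ℝ) * ((2 ^ P.J₀ℓ * ⌊cSp * mRp d * P.nWstarℓ⌋₊ : ℕ) : ℝ) by
    exact_mod_cast key
  have hprod : (2 : ℝ) ^ 9 * mRp d ^ 2 * P.nVθ * ((P.Lθℓ : ℝ) * (cSp * mRp d * P.nWstarℓ / 2)) ≤
      ((P.Tℓ / 2 ^ P.J₀ℓ - ∑ j, P.Lℓ j / 2 ^ P.J₀ℓ : ℕ) : ℝ) * ((2 ^ P.J₀ℓ * ⌊cSp * mRp d * P.nWstarℓ⌋₊ : ℕ) : ℝ) :=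
    by
      have hc : (0 : ℝ) < cSp := by unfold cSp; norm_num
      have h0 : (0 : ℝ) ≤ cSp * mRp d * P.nWstarℓ / 2 := by positivity
      exact mul_le_mul hT' hodd (mul_nonneg (Nat.cast_nonneg _) h0) (Nat.cast_nonneg _)
  refine lt_of_lt_of_le ?_ hprod
  -- `2^9 m² nVθ Lθ c_S m nW⋆/2 = (2^8 c_S m³ nW⋆)(Lθ nVθ) ≥ 2^8 c_S m³ nW⋆ · 𝔘/(8 c_L' c_S m² W⋆) = 32 m 𝔘/(c_L' ℓ) ≥ 𝔘/(64ℓ)`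
  have h32 : P.𝔘ℓ / (64 * P.ℓ) ≤ (2 : ℝ) ^ 9 * mRp d ^ 2 * P.nVθ * ((P.Lθℓ : ℝ) * (cSp * mRp d * P.nWstarℓ / 2)) := by
    have e : (2 : ℝ) ^ 9 * mRp d ^ 2 * P.nVθ * ((P.Lθℓ : ℝ) * (cSp * mRp d * P.nWstarℓ / 2)) =
        (2 ^ 8 * cSp * mRp d ^ 3 * P.nWstarℓ) * ((P.Lθℓ : ℝ) * P.nVθ) := by ring
    rw [e]
    have h0 : (0 : ℝ) ≤ 2 ^ 8 * cSp * mRp d ^ 3 * P.nWstarℓ := by unfold cSp; positivity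
    calc P.𝔘ℓ / (64 * P.ℓ) ≤ (2 ^ 8 * cSp * mRp d ^ 3 * P.nWstarℓ) * (P.𝔘ℓ / (8 * cLp' * cSp * mRp d ^ 2 * P.Wstarℓ)) := by
          unfold cLp' cSp
          rw [P.Wstar_eq, mul_div_assoc', div_le_div_iff₀ (by positivity) (by positivity)]
          have h0' : 0 ≤ mRp d ^ 2 * P.nWstarℓ * P.𝔘ℓ * P.ℓ := by positivity
          have h2m : 2 * (mRp d ^ 2 * P.nWstarℓ * P.𝔘ℓ * P.ℓ) ≤ mRp d * (mRp d ^ 2 * P.nWstarℓ * P.𝔘ℓ * P.ℓ) :=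
            mul_le_mul_of_nonneg_right hm h0'
          calc P.𝔘ℓ * (8 * (2 : ℝ) ^ 12 * 2 ^ 15 * mRp d ^ 2 * (P.ℓ * P.nWstarℓ))
              = 2 ^ 29 * (2 * (mRp d ^ 2 * P.nWstarℓ * P.𝔘ℓ * P.ℓ)) := by ring
            _ ≤ 2 ^ 29 * (mRp d * (mRp d ^ 2 * P.nWstarℓ * P.𝔘ℓ * P.ℓ)) := by linarith
            _ = 2 ^ 8 * 2 ^ 15 * mRp d ^ 3 * P.nWstarℓ * P.𝔘ℓ * (64 * P.ℓ) := by ring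
      _ ≤ (2 ^ 8 * cSp * mRp d ^ 3 * P.nWstarℓ) * ((P.Lθℓ : ℝ) * P.nVθ) := mul_le_mul_of_nonneg_left hLV h0
  -- `h L_b ≤ (𝔘/c_L + 4W⋆)/ℓ < 𝔘/(64 ℓ)`
  have hsmall : P.𝔘ℓ / cLp + (P.Wstarℓ + P.Gℓ) < P.𝔘ℓ / 64 := by unfold cLp; linarith
  have hlhs' : (P.hparℓ : ℝ) * P.Lbℓ < P.𝔘ℓ / (64 * P.ℓ) := by
    rw [lt_div_iff₀ (by positivity)]
    calc (P.hparℓ : ℝ) * P.Lbℓ * (64 * P.ℓ) = 64 * ((P.hparℓ : ℝ) * P.Lbℓ * P.ℓ) := by ring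
      _ ≤ 64 * (P.𝔘ℓ / cLp + (P.Wstarℓ + P.Gℓ)) := by gcongr
      _ < 64 * (P.𝔘ℓ / 64) := by gcongr
      _ = P.𝔘ℓ := by ring
  linarith


end PadicW80ParL

end Summit.ABC.StewartYu

end
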